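import Literature.Geometry.Riemannian.SphericalZonalSixPositivity
import Literature.Geometry.Riemannian.SphericalZonalFourDuality
import HarnessLib

/-!
# Non-negativity of the `S⁴` zonal heat series and uniform approximation by the polynomial flows

Fourth file on the typed zonal heat series `zonal τ s = ∑_k e^{-k(k+3)τ} (2k+3)/3 · C_k^{(3/2)}(s)`
of `SphericalCylinderEntropy.lean` (`vol(S⁴)` times the heat kernel of the round `S⁴`).  For
`τ > 0`:

* `zonal_nonneg` — **`zonal τ s ≥ 0` on `[-1, 1]`** (positivity of the heat kernel), by the
  duality `∫ (1-s²) zonal(τ,s) q(s) ds ≥ 0` for polynomials `q ≥ 0` (`SphericalZonalFourDuality`)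
  and Weierstrass approximation of the negative part, exactly as `zonalSix_nonneg`;
* `gegenbauerSum_one_pos`, `one_le_zonal_one` — `C_n^{(a)}(1) > 0` (`a > 0`) and `zonal τ 1 ≥ 1`;
* `partialSum_zonal_add_eq_gegenbauerHeat` — the partial sums at the shifted time `τ + σ`, plus a
  constant `ε`, form the polynomial heat flow `gegenbauerHeat 1 b J` of
  `GegenbauerHeatPositivity.lean` (`b_j = e^{-j(j+3)σ}(j+3/2)/(3/2) + ε δ_{j0}`);
* `norm_zonal_sub_partialSum_le`, `eventually_partialSum_add_pos` — the partial sums converge to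
  `zonal` uniformly on `[-1,1] × [σ, T]` (`σ > 0`, majorant of `SphericalZonalKernelSeries`), so
  `Σ_{j<J} wt j t C_j(s) + ε > 0` there for `J` large.

These feed the Li–Yau–Hamilton argument of `SphericalZonalHamiltonHarnack.lean`.  Everything is
proved; no named facts.

## References
* E. B. Davies, *Heat Kernels and Spectral Theory*, CUP 1989, Ch. 5. [Davies1989]
* R. S. Hamilton, Comm. Anal. Geom. 1 (1993) 113–126. [Hamilton1993Harnack]
-/

noncomputable section

open Set Filter MeasureTheory intervalIntegral Polynomial
open scoped Topology BigOperators Polynomial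
open Literature.Geometry.Riemannian.SphericalCylinderEntropy
open Literature.Analysis.SpecialFunctions

namespace Literature.Geometry.Riemannian.SphericalZonalKernelSeries

/-! ### Non-negativity of the `S⁴` zonal series -/

/-- **Non-negativity of the `S⁴` zonal heat series**: `zonal τ s ≥ 0` for `τ > 0`, `s ∈ [-1,1]`
(positivity of the heat kernel of the round `S⁴`).
[cite: Davies1989, Ch. 5 (positivity of heat kernels)] -/
theorem zonal_nonneg {τ : ℝ} (hτ : 0 < τ) : ∀ s ∈ Icc (-1 : ℝ) 1, 0 ≤ zonal τ s := by
  set Z : ℝ → ℝ := zonal τ with hZ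
  have hZc : Continuous Z := continuous_zonal hτ
  -- the negative part `f = -min(Z, 0)`
  set f : ℝ → ℝ := fun s => -min (Z s) 0 with hf
  have hfc : Continuous f := (hZc.min continuous_const).neg
  have hf0 : ∀ s, 0 ≤ f s := fun s => by simp only [hf]; linarith [min_le_right (Z s) 0]
  have hZf : ∀ s, Z s * f s = -(f s ^ 2) := by
    intro s
    simp only [hf]
    rcases le_total (Z s) 0 with h | h
    · rw [min_eq_left h]; ring
    · rw [min_eq_right h]; ring
  -- a bound for `(1-s²) Z` on `[-1, 1]`
  obtain ⟨B, hB⟩ := isCompact_Icc.exists_bound_of_continuousOn (s := Icc (-1 : ℝ) 1)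
    ((by fun_prop : Continuous fun s : ℝ => (1 - s ^ 2) * Z s).continuousOn)
  have hB0 : 0 ≤ B := (norm_nonneg _).trans (hB 0 (by norm_num))
  -- `∫ (1-s²) f² ≤ 4 ε B` for every `ε > 0`
  have hkey : ∫ s in (-1 : ℝ)..1, (1 - s ^ 2) * f s ^ 2 ≤ 0 := by
    refine le_of_forall_pos_le_add fun ε hε => ?_
    have hε4 : 0 < ε / (4 * B + 1) := div_pos hε (by linarith)
    obtain ⟨q, hq⟩ := exists_polynomial_near_of_continuousOn (-1) 1 f hfc.continuousOn _ hε4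
    set η := ε / (4 * B + 1) with hη
    set p : ℝ[X] := q + Polynomial.C η with hp
    have hp_eval : ∀ x, p.eval x = q.eval x + η := fun x => by simp [hp]
    have hpf : ∀ x ∈ Icc (-1 : ℝ) 1, f x ≤ p.eval x ∧ p.eval x ≤ f x + 2 * η := by
      intro x hx
      have h := abs_lt.1 (hq x hx)
      rw [hp_eval]
      constructor <;> linarith
    have hp0 : ∀ x ∈ Icc (-1 : ℝ) 1, 0 ≤ p.eval x := fun x hx => (hf0 x).trans (hpf x hx).1
    have hdual := integral_weightOne_mul_zonal_mul_eval_nonneg hτ p hp0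
    have hi1 : IntervalIntegrable (fun s => (1 - s ^ 2) * Z s * p.eval s) volume (-1) 1 :=
      ((by fun_prop : Continuous fun s : ℝ => (1 - s ^ 2) * Z s).mul
        (Polynomial.continuous_eval₂ _ _)).intervalIntegrable _ _
    have hi2 : IntervalIntegrable (fun s => (1 - s ^ 2) * Z s * f s) volume (-1) 1 :=
      ((by fun_prop : Continuous fun s : ℝ => (1 - s ^ 2) * Z s).mul hfc).intervalIntegrable _ _
    have hdiff : ‖∫ s in (-1 : ℝ)..1, ((1 - s ^ 2) * Z s * p.eval s - (1 - s ^ 2) * Z s * f s)‖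
        ≤ B * (2 * η) * |1 - (-1)| := by
      refine intervalIntegral.norm_integral_le_of_norm_le_const fun s hs => ?_
      rw [uIoc_of_le (by norm_num)] at hs
      have hs' : s ∈ Icc (-1 : ℝ) 1 := ⟨hs.1.le, hs.2⟩
      rw [show (1 - s ^ 2) * Z s * p.eval s - (1 - s ^ 2) * Z s * f s =
        ((1 - s ^ 2) * Z s) * (p.eval s - f s) by ring, norm_mul]
      refine mul_le_mul (hB s hs') ?_ (norm_nonneg _) hB0
      rw [Real.norm_eq_abs, abs_le]
      constructor <;> linarith [(hpf s hs').1, (hpf s hs').2]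
    rw [intervalIntegral.integral_sub hi1 hi2, Real.norm_eq_abs] at hdiff
    have hZf' : ∫ s in (-1 : ℝ)..1, (1 - s ^ 2) * Z s * f s =
        -∫ s in (-1 : ℝ)..1, (1 - s ^ 2) * f s ^ 2 := by
      rw [← intervalIntegral.integral_neg]
      refine intervalIntegral.integral_congr fun s _ => ?_
      simp only [mul_assoc, hZf s]
      ring
    rw [hZf'] at hdiff
    have habs := (abs_le.1 hdiff).2
    have h4 : B * (2 * η) * |1 - (-1 : ℝ)| = 4 * B * η := by
      rw [show (1 : ℝ) - (-1) = 2 by ring, abs_of_pos (by norm_num : (0 : ℝ) < 2)]; ring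
    rw [h4] at habs
    have hηε : 4 * B * η ≤ ε := by
      rw [hη, mul_div_assoc', div_le_iff₀ (by linarith : (0 : ℝ) < 4 * B + 1)]
      nlinarith
    have hd : (0 : ℝ) ≤ ∫ s in (-1 : ℝ)..1, (1 - s ^ 2) * Z s * p.eval s := by
      simpa only [hZ] using hdual
    linarith
  -- pass to the weight `(1-s²)²` and conclude as for `S⁶`
  have hkey2 : ∫ s in (-1 : ℝ)..1, (1 - s ^ 2) ^ 2 * f s ^ 2 ≤ 0 := by
    refine le_trans (intervalIntegral.integral_mono_on (by norm_num)
      ((by fun_prop : Continuous fun s : ℝ => (1 - s ^ 2) ^ 2 * f s ^ 2).intervalIntegrable _ _)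
      ((by fun_prop : Continuous fun s : ℝ => (1 - s ^ 2) * f s ^ 2).intervalIntegrable _ _)
      fun s hs => ?_) hkey
    have h1 : 0 ≤ 1 - s ^ 2 := by nlinarith [hs.1, hs.2]
    have h2 : 1 - s ^ 2 ≤ 1 := by nlinarith [sq_nonneg s]
    nlinarith [mul_le_mul_of_nonneg_right h2 (mul_nonneg h1 (sq_nonneg (f s)))]
  have hopen : ∀ y ∈ Ioo (-1 : ℝ) 1, 0 ≤ Z y := by
    intro y hy
    have h := eq_zero_of_integral_weight_mul_sq_nonpos hfc hkey2 hy
    simp only [hf, neg_eq_zero] at h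
    by_contra hneg
    push Not at hneg
    rw [min_eq_left hneg.le] at h
    exact hneg.ne h
  have hclosed : IsClosed {y : ℝ | 0 ≤ Z y} := isClosed_le continuous_const hZc
  have := hclosed.closure_subset_iff.2 (show Ioo (-1 : ℝ) 1 ⊆ _ from hopen)
  rw [closure_Ioo (by norm_num : (-1 : ℝ) ≠ 1)] at this
  exact fun s hs => this hs

/-! ### The value at the pole -/

/-- `C_n^{(a)}(1) > 0` for `a > 0` (from `(n+1) C_{n+1}(1) = (n+2a) C_n(1)`). [folklore] -/
theorem gegenbauerSum_one_pos {a : ℝ} (ha : 0 < a) : ∀ n : ℕ, 0 < gegenbauerSum a n 1 := by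
  intro n
  induction n with
  | zero => simp
  | succ n ih =>
    have h := gegenbauerSum_at_one_rec a n
    have hn : (0 : ℝ) < (n : ℝ) + 1 := by positivity
    have hpos : 0 < ((n : ℝ) + 2 * a) * gegenbauerSum a n 1 := mul_pos (by positivity) ih
    nlinarith

/-- `zonal τ 1 ≥ 1` for `τ > 0` (all modes are non-negative at the pole, the `k = 0` mode is `1`).
[folklore] -/
theorem one_le_zonal_one {τ : ℝ} (hτ : 0 < τ) : 1 ≤ zonal τ 1 := by
  rw [zonal_eq_one_add_tsum hτ 1]
  have h : 0 ≤ ∑' j : ℕ, wt (j + 1) τ * gegen (j + 1) 1 := by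
    refine tsum_nonneg fun j => mul_nonneg (wt_pos _ _).le ?_
    rw [gegen_eq_gegenbauerSum]
    exact (gegenbauerSum_one_pos (by norm_num) _).le
  linarith

/-! ### The partial sums as a polynomial heat flow -/

/-- The partial sums of the zonal series at the shifted time `τ + σ`, plus the constant `ε`, are
the polynomial heat flow `gegenbauerHeat 1 b J` with
`b_j = e^{-j(j+3)σ} (j + 3/2)/(3/2) + ε δ_{j0}` (`J ≥ 1`). [folklore] -/
theorem partialSum_zonal_add_eq_gegenbauerHeat (σ τ s ε : ℝ) {J : ℕ} (hJ : 0 < J) :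
    ∑ j ∈ Finset.range J, wt j (τ + σ) * gegen j s + ε =
      gegenbauerHeat 1 (fun j : ℕ => Real.exp (-((j : ℝ) * ((j : ℝ) + 2 * (1 : ℕ) + 1) * σ)) *
        (((j : ℝ) + (((1 : ℕ) : ℝ) + 1 / 2)) / (((1 : ℕ) : ℝ) + 1 / 2)) +
          if j = 0 then ε else 0) J s τ := by
  unfold gegenbauerHeat
  simp only [add_mul, Finset.sum_add_distrib, ite_mul, zero_mul]
  rw [Finset.sum_ite_eq']
  simp only [Finset.mem_range, hJ, if_true, Nat.cast_zero, zero_mul, neg_zero, zero_add,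
    Real.exp_zero, mul_one, gegenbauerSum_zero]
  congr 1
  refine Finset.sum_congr rfl fun j _ => ?_
  rw [wt_eq, gegen_eq_gegenbauerSum]
  have h : Real.exp (-((j : ℝ) * ((j : ℝ) + 2 * (1 : ℕ) + 1) * (τ + σ))) =
      Real.exp (-((j : ℝ) * ((j : ℝ) + 2 * (1 : ℕ) + 1) * σ)) *
        Real.exp (-((j : ℝ) * ((j : ℝ) + 2 * (1 : ℕ) + 1) * τ)) := by
    rw [← Real.exp_add]; ring_nf
  rw [h]
  push_cast
  ring

/-! ### Uniform convergence of the partial sums on `[-1,1] × [σ, T]` -/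

/-- Uniform tail bound: for `0 < σ ≤ t` and `s ∈ [-1,1]`,
`|zonal t s - Σ_{j<J} wt j t C_j(s)| ≤ Σ_{j ≥ J} e^{-j²σ} ((j+3)!)² 2^j`. [folklore] -/
theorem norm_zonal_sub_partialSum_le {σ t s : ℝ} (hσ : 0 < σ) (hσt : σ ≤ t)
    (hs : s ∈ Icc (-1 : ℝ) 1) (J : ℕ) :
    ‖zonal t s - ∑ j ∈ Finset.range J, wt j t * gegen j s‖ ≤
      ∑' j : ℕ, Real.exp (-((j + J : ℕ) : ℝ) ^ 2 * σ) * ((((j + J) + 3).factorial : ℕ) : ℝ) ^ 2 *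
        (2 * 1) ^ (j + J) := by
  have ht : 0 < t := hσ.trans_le hσt
  have hsum := summable_wt_mul_gegen ht s
  have hsplit := hsum.sum_add_tsum_nat_add J
  rw [zonal, ← hsplit, add_sub_cancel_left]
  have hmaj : Summable fun j : ℕ =>
      Real.exp (-((j + J : ℕ) : ℝ) ^ 2 * σ) * ((((j + J) + 3).factorial : ℕ) : ℝ) ^ 2 *
        (2 * 1) ^ (j + J) :=
    (summable_nat_add_iff (f := fun k : ℕ =>
      Real.exp (-(k : ℝ) ^ 2 * σ) * (((k + 3).factorial : ℕ) : ℝ) ^ 2 * (2 * 1) ^ k) J).2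
      (summable_majorant hσ (by norm_num))
  refine tsum_of_norm_bounded hmaj.hasSum fun j => ?_
  have hs' : |s| ≤ 1 := abs_le.2 ⟨hs.1, hs.2⟩
  refine (norm_wt_mul_gegen_le ht le_rfl hs' (j + J)).trans ?_
  refine mul_le_mul_of_nonneg_right (mul_le_mul_of_nonneg_right ?_ (by positivity))
    (by positivity)
  exact Real.exp_le_exp.2 (by nlinarith [sq_nonneg (((j + J : ℕ) : ℝ))])

/-- **Uniform approximation**: for `σ > 0`, `ε > 0`, eventually in `J`,
`Σ_{j<J} wt j t C_j(s) + ε > 0` for all `(s, t) ∈ [-1,1] × [σ, T]` (the tail is uniformly small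
and `zonal ≥ 0`). [folklore] -/
theorem eventually_partialSum_add_pos {σ T ε : ℝ} (hσ : 0 < σ) (hε : 0 < ε) :
    ∀ᶠ J : ℕ in atTop, ∀ s ∈ Icc (-1 : ℝ) 1, ∀ t ∈ Icc σ T,
      0 < ∑ j ∈ Finset.range J, wt j t * gegen j s + ε := by
  have htail := tendsto_sum_nat_add fun k : ℕ =>
    Real.exp (-(k : ℝ) ^ 2 * σ) * (((k + 3).factorial : ℕ) : ℝ) ^ 2 * (2 * 1) ^ k
  filter_upwards [(tendsto_order.1 htail).2 ε hε] with J hJ s hs t ht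
  have htpos : 0 < t := hσ.trans_le ht.1
  have hlow : 0 ≤ zonal t s := zonal_nonneg htpos s hs
  have hdiff := norm_zonal_sub_partialSum_le hσ ht.1 hs J
  rw [Real.norm_eq_abs] at hdiff
  have := (abs_sub_lt_iff.1 (hdiff.trans_lt hJ)).1
  linarith

end Literature.Geometry.Riemannian.SphericalZonalKernelSeries
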